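import Summits.HodgeConjecture.CorCM.B01.Transposition.Item6CentralTypeAtPinCanonical
import Summits.HodgeConjecture.CorCM.B01.Transposition.Item6CentralTypeAtPinConj
import Summits.HodgeConjecture.CorCM.D2Bridge.IndexInhabited
import HarnessLib

/-!
# The pinned index of record: its CONTINUOUS part is inhabited IFF `ι₁` is the canonical embedding of its place

Cell pub-hodgecm2 (COR-CM), seat pin-3 (gen 14), 2026-08-24.  The two halves of the orientation criterion for the index of record
`I V (repAt a₀) (muLiu ι₁ GramClass.rep)` (the `h418` binder's enumeration) joined in one `Iff`:

* ⟹ pin-3 ✔ `CentralTypeAtPin.embedding_mk_eq_of_continuous_indexOfRecord` (`Transposition/Item6CentralTypeAtPinCanonical`, [GR91 §3.1]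
  central-type rigidity): a continuous index line forces `(mk ι₁).embedding = ι₁`;
* ⟸ rekey-l0-pin-a ✔ `IndexInhabited.exists_index_phiMu_continuous[_self]` (`D2Bridge/IndexInhabited`, pin-3's pointed constructor at a
  weight-one character): under `hemb` a `PhiMu` index line with CONTINUOUS pair splitting exists over every δ-positive class — and one of the
  classes `⟦a₀⟧`, `⟦−a₀⟧` is δ-positive for `ι₁` (`Φ^δ(−a₀)` is the complement of `Φ^δ(a₀)`, pin-3 ✔ `mem_lineType_iff_not_mem_of_val_eq_neg`).

`exists_continuous_index_iff_embedding_mk_eq`, `exists_phiMu_continuous_index_iff_embedding_mk_eq` (the side conditions `(hi : PhiMuLine …)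
(hg : Continuous …)` under which every END's Δ2 citation binders quantify), `nonempty_continuous_index_iff_embedding_mk_eq`.
KERNEL only (theorems).  HC_CM is NOT proved here or anywhere; no pointer moves.
-/

set_option autoImplicit false

noncomputable section

namespace Summit.HodgeConjecture.CorCM.Transposition.CentralTypeAtPin

open NumberField NumberField.InfinitePlace
open HodgeCM HodgeCM.Model HodgeCM.Model.LiuIndex
open HodgeCM.SignRecipe (lineType)
open Summit.HodgeConjecture.CorCM.D2Bridge (IndexInhabited.exists_index_phiMu_continuous IndexInhabited.exists_index_phiMu_continuous_self)

variable {L : CMField} {ι₁ : (L : Type) →+* ℂ} (V : HermSpace3 L ι₁) (a₀ : RealScalar L)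

set_option maxHeartbeats 4000000 in
/-- **under `hemb` there is a `PhiMu` index line with CONTINUOUS pair splitting** (no δ-positivity hypothesis): over `⟦a₀⟧` if `ι₁ ∈ Φ^δ(a₀)`,
else over `⟦−a₀⟧` (`ι₁ ∈ Φ^δ(−a₀) ↔ ι₁ ∉ Φ^δ(a₀)`; the line type of the representative `repAt a₀ ⟦−a₀⟧` is `Φ^δ(−a₀)`, `lineType_scalar_mk`).
[cite: Liu2021, Def. 4.12, Prop. 4.13] [cite: GelbartRogawski1991, §3.1 Prop. 3.1.1 p. 455] -/
theorem exists_phiMu_continuous_index_of_embedding_mk_eq (hemb : (InfinitePlace.mk ι₁).embedding = ι₁) :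
    ∃ j : I V (repAt a₀) (muLiu ι₁ GramClass.rep),
      SplitLine.PhiMuLine ι₁ (line V (repAt a₀) (muLiu ι₁ GramClass.rep) j) ∧ Continuous (j.2.1 : SplittingAt V (repAt a₀ j.1)) := by
  by_cases ha₀ : ι₁ ∈ (lineType a₀.1 a₀.2.1 a₀.2.2).1
  · obtain ⟨j, -, hj, hc⟩ := IndexInhabited.exists_index_phiMu_continuous_self V hemb a₀ ha₀
    exact ⟨j, hj, hc⟩
  · -- over the class of ANY real non-zero scalar `a'` with `a'.1 = −a₀.1` (the opposite line), e.g. `⟨−a₀.1, …⟩`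
    have key : ∀ a' : RealScalar L, a'.1 = -a₀.1 → ∃ j : I V (repAt a₀) (muLiu ι₁ GramClass.rep),
        SplitLine.PhiMuLine ι₁ (line V (repAt a₀) (muLiu ι₁ GramClass.rep) j) ∧ Continuous (j.2.1 : SplittingAt V (repAt a₀ j.1)) := by
      intro a' ha'
      have hmem : ι₁ ∈ (lineType a'.1 a'.2.1 a'.2.2).1 := (mem_lineType_iff_not_mem_of_val_eq_neg a₀ a' ha' ι₁).2 ha₀
      have hq : ι₁ ∈ (lineType (repAt a₀ (GramClass.mk a')).1 (repAt a₀ (GramClass.mk a')).2.1 (repAt a₀ (GramClass.mk a')).2.2).1 := by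
        change ι₁ ∈ (lineType (GramClass.scalar (repAt a₀) (GramClass.mk a')) (GramClass.conj_scalar (repAt a₀) _)
          (GramClass.scalar_ne (repAt a₀) _)).1
        rw [lineType_scalar_mk (fun q => repAt_spec a₀ q) a']
        exact hmem
      obtain ⟨j, -, hj, hc⟩ := IndexInhabited.exists_index_phiMu_continuous V hemb a₀ (GramClass.mk a') hq
      exact ⟨j, hj, hc⟩
    exact key ⟨-a₀.1, by rw [map_neg, a₀.2.1], neg_ne_zero.2 a₀.2.2⟩ rfl

set_option maxHeartbeats 4000000 in
/-- **THE ORIENTATION CRITERION OF THE PINNED INDEX**: the index of record `I V (repAt a₀) (muLiu ι₁ GramClass.rep)` has an index line with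
CONTINUOUS pair splitting IFF `ι₁` is the canonical embedding of its place.  (⟹ `embedding_mk_eq_of_continuous_indexOfRecord`, [GR91 §3.1]
rigidity; ⟸ `exists_phiMu_continuous_index_of_embedding_mk_eq`.)
[cite: GelbartRogawski1991, §3.1 Prop. 3.1.1 p. 455 L1–3, Remark p. 457 L4–13] [cite: Liu2021, Def. 4.12, Prop. 4.13] -/
theorem exists_continuous_index_iff_embedding_mk_eq :
    (∃ i : I V (repAt a₀) (muLiu ι₁ GramClass.rep), Continuous (i.2.1 : SplittingAt V (repAt a₀ i.1))) ↔
      (InfinitePlace.mk ι₁).embedding = ι₁ := by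
  constructor
  · rintro ⟨i, hi⟩
    exact embedding_mk_eq_of_continuous_indexOfRecord V a₀ i hi
  · intro hemb
    obtain ⟨j, -, hc⟩ := exists_phiMu_continuous_index_of_embedding_mk_eq V a₀ hemb
    exact ⟨j, hc⟩

set_option maxHeartbeats 4000000 in
/-- the same with the `PhiMu` clause: **the side conditions `(hi : PhiMuLine ι₁ (line i)) (hg : Continuous i.2.1)` of the END files' Δ2
citation binders are JOINTLY SATISFIABLE iff `(mk ι₁).embedding = ι₁`** — at a non-canonical `ι₁` those binders quantify over nothing.
[cite: GelbartRogawski1991, §3.1 Prop. 3.1.1 p. 455 L1–3, Remark p. 457 L4–13] [cite: Liu2021, Def. 4.12, Prop. 4.13] -/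
theorem exists_phiMu_continuous_index_iff_embedding_mk_eq :
    (∃ i : I V (repAt a₀) (muLiu ι₁ GramClass.rep),
        SplitLine.PhiMuLine ι₁ (line V (repAt a₀) (muLiu ι₁ GramClass.rep) i) ∧ Continuous (i.2.1 : SplittingAt V (repAt a₀ i.1))) ↔
      (InfinitePlace.mk ι₁).embedding = ι₁ := by
  constructor
  · rintro ⟨i, -, hi⟩
    exact embedding_mk_eq_of_continuous_indexOfRecord V a₀ i hi
  · exact exists_phiMu_continuous_index_of_embedding_mk_eq V a₀

set_option maxHeartbeats 4000000 in
/-- `Nonempty` form of the criterion. [cite: GelbartRogawski1991, §3.1 Prop. 3.1.1 p. 455 L1–3, Remark p. 457 L4–13] -/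
theorem nonempty_continuous_index_iff_embedding_mk_eq :
    Nonempty {i : I V (repAt a₀) (muLiu ι₁ GramClass.rep) // Continuous (i.2.1 : SplittingAt V (repAt a₀ i.1))} ↔
      (InfinitePlace.mk ι₁).embedding = ι₁ := by
  constructor
  · rintro ⟨i⟩
    exact embedding_mk_eq_of_continuous_indexOfRecord V a₀ i.1 i.2
  · intro hemb
    obtain ⟨j, -, hc⟩ := exists_phiMu_continuous_index_of_embedding_mk_eq V a₀ hemb
    exact ⟨⟨j, hc⟩⟩

end Summit.HodgeConjecture.CorCM.Transposition.CentralTypeAtPin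

end
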